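import Summits.ABC.ABC.Theses.DefiniteXi
import Literature.NumberTheory.Automorphic.BCDTModularity
import Literature.NumberTheory.EllipticCurves.X1ElevenFiveIsogeny
import Literature.NumberTheory.EllipticCurves.SzpiroLocalDataProofs
import Literature.NumberTheory.EllipticCurves.SzpiroFreyProofs
import Literature.NumberTheory.EllipticCurves.MazurTorsionGaloisStructureProofs
import HarnessLib

/-!
# `FreyModularity` (stmt-ABC-11340), line `Sketch` — stub `stub_absIrrSqrtFive` needs irreducibility

Negative support for crux stmt-ABC-11340 (`Summit.ABC.ABC.Theses.DefiniteXi.FreyModularity`), written by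
the crux disprover (`refuter-cdisprove-stmt-ABC-11340-0`, 2026-08-16, `Cruxes/FreyModularity/Disproof.lean`
finding B2).  The picked line `Sketch` has the stub (Rubin, CSS 1997, Prop. 7)

  `stub_absIrrSqrtFive : ∀ E/ℚ elliptic, ¬ 25 ∣ N_E → ∀ ρ̄ = E[5] framed, ρ̄ irreducible →
     ρ̄|_{ℚ(√5)} absolutely irreducible`.

This file proves that the statement with the IRREDUCIBILITY hypothesis dropped is FALSE, witness Cremona's
`11A1 = X₀(11)`: `5 ∤ N(11A1)` (the integral model `[0,-1,1,-10,-20]` has `5 ∤ Δ = -11⁵`, so `f₅ = 0`,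
B–G 12.5.9(a)); its rational point `T' = (5,5)` has order `5`, so `⟨T̄'⟩` is a `Γ_ℚ`-stable line and `E[5]`
is reducible (the tree's `not_hasIrreducibleModPGaloisRep_of_addOrderOf_eq`); a framed `ρ̄_{E,5}` exists,
and absolute irreducibility over `ℚ(√5)` would make it irreducible over `𝔽₅`.  On the way the converse of
the tree's `BCDT.isIrreducible_of_hasIrreducibleModPGaloisRep` is proved
(`hasIrreducibleModPGaloisRep_of_isIrreducible`: an irreducible framed model forces `E[p]` to have no
`Γ`-stable subgroup other than `0`, `E[p]`).

What this does NOT say: nothing against the stub as filed; the OTHER hypothesis `¬ 25 ∣ N` is also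
load-bearing (curves `5`-congruent to their quadratic twist by `5`, e.g. `y² = x³ + 80`, `N = 225`, kit
j016573) but that witness is not certifiable in the tree (no Frobenius interface on `E[5]`).
-/

-- `Summit.<Summit>.<Problem>`: for the single-conjunct summit `ABC` the duplicate `ABC.ABC` is mandated.
set_option linter.dupNamespace false

noncomputable section

open scoped MatrixGroups

open Literature.NumberTheory.EllipticCurves
open Literature.NumberTheory.Automorphic
open Literature.NumberTheory.GaloisRepresentations
open WeierstrassCurve

namespace Summit.ABC.ABC.Theorems.FreyModularity.Negative

/-- **An irreducible framed model of `E[p]` makes `E[p]` irreducible** (converse transport to the tree's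
`BCDT.isIrreducible_of_hasIrreducibleModPGaloisRep`): push a `Γ`-stable subgroup `H ≤ E[p]` through the
frame `e : E[p] ≃ 𝔽_p²`; its image is an `𝔽_p`-subspace (`AddSubgroup.toZModSubmodule`) stable under every
`ρ̄(σ)` since `e(σ • P) = ρ̄(σ) e(P)`, hence `⊥` or `⊤` (Mathlib `Representation.IsIrreducible`).
[folklore] -/
theorem hasIrreducibleModPGaloisRep_of_isIrreducible {F : Type} [Field F] {W : WeierstrassCurve F}
    {p : ℕ} [Fact p.Prime] {ρ : ModPGaloisRep F (ZMod p) 2} (hρ : W.IsTorsionGaloisRep p ρ)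
    (hirr : FramedRep.IsIrreducible ρ) : W.HasIrreducibleModPGaloisRep p := by
  obtain ⟨e, he⟩ := hρ
  intro H hH
  let S : AddSubgroup (Fin 2 → ZMod p) := H.map e.toAddMonoidHom
  have hSmem : ∀ v, v ∈ S ↔ ∃ Q ∈ H, e Q = v := fun v ↦ by
    rw [AddSubgroup.mem_map]
    exact ⟨fun ⟨Q, hQ, hv⟩ ↦ ⟨Q, hQ, hv⟩, fun ⟨Q, hQ, hv⟩ ↦ ⟨Q, hQ, hv⟩⟩
  let V : Subrepresentation (FramedRep.toRepresentation ρ) :=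
    { toSubmodule := AddSubgroup.toZModSubmodule p S
      apply_mem_toSubmodule := fun σ v hv ↦ by
        rw [AddSubgroup.mem_toZModSubmodule] at hv ⊢
        obtain ⟨Q, hQ, rfl⟩ := (hSmem v).mp hv
        rw [FramedRep.toRepresentation_apply_apply, ← he σ Q]
        exact (hSmem _).mpr ⟨σ • Q, hH σ Q hQ, rfl⟩ }
  have hVmem : ∀ v, v ∈ V.toSubmodule ↔ v ∈ S := fun v ↦ AddSubgroup.mem_toZModSubmodule p
  rcases hirr.eq_bot_or_eq_top V with hV | hV
  · left
    refine (AddSubgroup.eq_bot_iff_forall _).mpr fun Q hQ ↦ ?_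
    have hQS : e Q ∈ V.toSubmodule := (hVmem _).mpr ((hSmem _).mpr ⟨Q, hQ, rfl⟩)
    have hbot : V.toSubmodule = ⊥ := congrArg Subrepresentation.toSubmodule hV
    rw [hbot, Submodule.mem_bot] at hQS
    exact e.injective (hQS.trans (map_zero e).symm)
  · right
    refine (AddSubgroup.eq_top_iff' _).mpr fun Q ↦ ?_
    have htop : V.toSubmodule = ⊤ := congrArg Subrepresentation.toSubmodule hV
    have hQS : e Q ∈ V.toSubmodule := by rw [htop]; exact Submodule.mem_top
    obtain ⟨Q', hQ', hQQ'⟩ := (hSmem _).mp ((hVmem _).mp hQS)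
    exact e.injective hQQ' ▸ hQ'

/-- `11A1` over `ℚ` is the base change of the integral model `[0, -1, 1, -10, -20]`.
[cite: CremonaAlgorithms1997, Table 1, N = 11, curve A1] -/
theorem curve11A1_eq_baseChange :
    (⟨0, -1, 1, -10, -20⟩ : WeierstrassCurve ℤ).baseChange ℚ = X1Eleven.curve11A1 := by
  ext <;> simp [X1Eleven.curve11A1, WeierstrassCurve.baseChange, WeierstrassCurve.map]

/-- `Δ = -11⁵` on the integral model of `11A1`. [cite: CremonaAlgorithms1997, Table 1, N = 11, curve A1] -/
theorem int11A1_Δ : (⟨0, -1, 1, -10, -20⟩ : WeierstrassCurve ℤ).Δ = -11 ^ 5 := by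
  norm_num [WeierstrassCurve.Δ, WeierstrassCurve.b₂, WeierstrassCurve.b₄, WeierstrassCurve.b₆,
    WeierstrassCurve.b₈]

/-- **`5 ∤ N(11A1)`**: the integral model has `5 ∤ Δ = -11⁵`, so it is minimal at `5` with `f₅ = 0`
(`conductorExponent_eq_zero_of_not_dvd_Δ`, B–G 12.5.9(a)), and `N = ∏ p^{f_p}`
(`factorization_conductorNorm_primesEquiv_symm`). [cite: BombieriGubler2006, 12.5.9(a)] -/
theorem not_five_dvd_conductorNorm_curve11A1 : ¬ 5 ∣ X1Eleven.curve11A1.conductorNorm ℤ := by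
  rw [← curve11A1_eq_baseChange]
  set W₀ : WeierstrassCurve ℤ := ⟨0, -1, 1, -10, -20⟩ with hW₀
  haveI : (W₀.baseChange ℚ).IsElliptic := by rw [hW₀, curve11A1_eq_baseChange]; infer_instance
  obtain ⟨v, hv⟩ := exists_place ⟨5, Nat.prime_five⟩
  have hv' : (Rat.HeightOneSpectrum.primesEquiv (R := ℤ)).symm ⟨5, Nat.prime_five⟩ = v :=
    (Rat.HeightOneSpectrum.primesEquiv (R := ℤ)).symm_apply_eq.mpr (Subtype.ext hv.symm)
  have h5Δ : ¬ ((Rat.HeightOneSpectrum.natGenerator v : ℕ) : ℤ) ∣ W₀.Δ := by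
    rw [hv, hW₀, int11A1_Δ]; decide
  have hmin : (W₀.baseChange ℚ).IsMinimalAt v :=
    isMinimalAt_baseChange_int_of_not_pow_dvd_Δ fun h ↦ h5Δ (dvd_trans (dvd_pow_self _ (by norm_num)) h)
  have hf : (W₀.baseChange ℚ).conductorExponent v = 0 := conductorExponent_eq_zero_of_not_dvd_Δ hmin h5Δ
  intro h5
  have hN0 : (W₀.baseChange ℚ).conductorNorm ℤ ≠ 0 := (conductorNorm_pos_holds _).ne'
  have hfac := factorization_conductorNorm_primesEquiv_symm (W₀.baseChange ℚ) ⟨5, Nat.prime_five⟩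
  rw [hv', hf] at hfac
  exact absurd hfac (Nat.Prime.factorization_pos_of_dvd Nat.prime_five hN0 h5).ne'

/-- **`stub_absIrrSqrtFive` without the irreducibility hypothesis is false; witness `11A1`.**
`25 ∤ N(11A1)` (`not_five_dvd_conductorNorm_curve11A1`); `T' = (5,5)` has order `5`
(`X1Eleven.five_nsmul_T'`, `X1Eleven.T'_ne_zero`), so `E[5]` is reducible
(`not_hasIrreducibleModPGaloisRep_of_addOrderOf_eq`); a framed `ρ̄_{E,5}` exists
(`exists_isTorsionGaloisRep`), and were it absolutely irreducible over `ℚ(√5)` it would be irreducible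
over `𝔽₅` (`IsAbsIrreducibleOverSqrt.isAbsolutelyIrreducible`, `IsAbsolutelyIrreducible.isIrreducible`),
contradicting `hasIrreducibleModPGaloisRep_of_isIrreducible`. [cite: Mazur1977, Ch. III §5, p. 157] -/
theorem stub_absIrrSqrtFive_false_without_irreducible :
    ¬ ∀ (W : WeierstrassCurve ℚ) [W.IsElliptic], ¬ 25 ∣ W.conductorNorm ℤ →
        ∀ ρ : ModPGaloisRep ℚ (ZMod 5) 2, W.IsTorsionGaloisRep 5 ρ → ρ.IsAbsIrreducibleOverSqrt 5 := by
  intro h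
  haveI : NeZero ((5 : ℕ) : ℚ) := ⟨by norm_num⟩
  obtain ⟨ρ, hρ⟩ := X1Eleven.curve11A1.exists_isTorsionGaloisRep 5
  have h25 : ¬ 25 ∣ X1Eleven.curve11A1.conductorNorm ℤ :=
    fun h25 ↦ not_five_dvd_conductorNorm_curve11A1 (dvd_trans ⟨5, rfl⟩ h25)
  have hirr : FramedRep.IsIrreducible ρ :=
    (h X1Eleven.curve11A1 h25 ρ hρ).isAbsolutelyIrreducible.isIrreducible
  have hT : addOrderOf X1Eleven.T' = 5 :=
    addOrderOf_eq_prime (X1Eleven.five_nsmul_T') X1Eleven.T'_ne_zero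
  exact not_hasIrreducibleModPGaloisRep_of_addOrderOf_eq X1Eleven.curve11A1 hT
    (hasIrreducibleModPGaloisRep_of_isIrreducible hρ hirr)

end Summit.ABC.ABC.Theorems.FreyModularity.Negative

end
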